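import Literature.NumberTheory.Transcendental.KZCubeProducts
import Literature.NumberTheory.Transcendental.KZRelationsLE
import Literature.NumberTheory.Transcendental.KZLogCalculusProofs

/-!
# Route GenusOneIterated — support item `LegendreLemniscatic`, helper 3: the lemniscatic square is a
# Beta box

Helper for the support item `LegendreLemniscatic` (stmt-KontsevichZagierPeriods-6781) of route
`GenusOneIterated`: Legendre's relation `ω₁η₁ = π` for the lemniscatic curve `y² = 4x³ − 4x`, filed as
`[(-1,0)², −4x₁/(y₀y₁)] ∼ [ℝ, dv/(1+v²)]` inside the Kontsevich–Zagier calculus of moves. This file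
is the FIRST move of the chain: ONE change of variables (rule (2)) along the polynomial chart
`Φ(x₀,x₁) = (x₁², x₀²)` of the open unit box `(0,1)²` by the lemniscatic square `(-1,0)²`
(injective on the square, `|det DΦ| = 4x₀x₁ > 0`), under which

  `−4x₁ dx₀dx₁/(y₀y₁) = ¼ · u^{3/4−1}(1−u)^{1/2−1} · v^{1/4−1}(1−v)^{1/2−1} du dv`,
  `u = x₁²`, `v = x₀²` (`y = √(4x³−4x) = 2√(−x)·√(1−x²)` on `(-1,0)`),

i.e. `[(-1,0)², −4x₁/(y₀y₁)] ∼ ¼ · B` for every representation `B` PINNED as the cube Beta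
representation of the data `x = (¾, ¼)`, `y = (½, ½)` (`KZ.exists_cubeBetaRep`; value
`¼·B(¾,½)·B(¼,½) = (−η₁/2)·(−4)·(ω₁/2)/… = ω₁η₁`):

* `exists_lemniscaticSquareChart` — the chart, its derivative, injectivity, image and Jacobian;
* `lemniscaticSquare_pullback` — the pull-back identity displayed above;
* `lemniscaticSquare_equivalent_constMul` — the move.

No definitions are introduced (the chart and its derivative are written out); pure proof file.

References: M. Kontsevich, D. Zagier, *Periods* (2001), §1.2 rule (2); H. McKean, V. Moll,
*Elliptic Curves* (1999), §2.3 (the lemniscatic integrals as Beta values).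
-/

noncomputable section

-- `Summit.<Summit>.<Sub>` with Sub = Summit (single-conjunct summit, D-0017) duplicates the segment.
set_option linter.dupNamespace false

namespace Summit.KontsevichZagierPeriods.KontsevichZagierPeriods.Theorems

open MeasureTheory Set
open Literature.NumberTheory.Transcendental
open Literature.NumberTheory.Transcendental.KZ
open Literature.ModelTheory.ExponentialFields (IsSemialgebraic isSemialgebraic_univ)
open MvPolynomial (aeval X C)

/-! ## The lemniscatic square `(-1,0)²` and the box `(0,1)²` -/

/-- The lemniscatic square `(-1,0)²` (the item's spelling) is `ℚ`-semialgebraic. [folklore] -/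
theorem isSemialgebraic_lemniscaticSquare :
    IsSemialgebraic ℚ {x : Fin 2 → ℝ | -1 < x 0 ∧ x 0 < 0 ∧ -1 < x 1 ∧ x 1 < 0} := by
  have h := isSemialgebraic_setOf_forall_aeval_pos
    ![(MvPolynomial.X 0 + 1 : MvPolynomial (Fin 2) ℚ), -MvPolynomial.X 0, MvPolynomial.X 1 + 1,
      -MvPolynomial.X 1]
  convert h using 1
  ext x
  simp only [mem_setOf_eq, Fin.forall_fin_succ, Matrix.cons_val_zero, Matrix.cons_val_succ, map_add,
    map_neg, map_one, MvPolynomial.aeval_X, IsEmpty.forall_iff, and_true]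
  constructor
  · rintro ⟨h0, h1, h2, h3⟩; exact ⟨by linarith, by linarith, by linarith, by linarith⟩
  · rintro ⟨h0, h1, h2, h3⟩; exact ⟨by linarith, by linarith, by linarith, by linarith⟩

/-! ## The chart `Φ(x₀,x₁) = (x₁², x₀²)` -/

/-- **The chart `Φ(x₀,x₁) = (x₁², x₀²)`** of the open unit box by the lemniscatic square `(-1,0)²`: a
`ℚ`-polynomial map, differentiable with `|det DΦ| = 4x₀x₁` on the square, injective there (both
coordinates are negative) and ONTO the box (inverse `(u,v) ↦ (−√v, −√u)`). [folklore] -/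
theorem exists_lemniscaticSquareChart :
    ∃ (Φ : (Fin 2 → ℝ) → (Fin 2 → ℝ)) (Φ' : (Fin 2 → ℝ) → (Fin 2 → ℝ) →L[ℝ] (Fin 2 → ℝ)),
      (∀ z, Φ z 0 = z 1 * z 1) ∧ (∀ z, Φ z 1 = z 0 * z 0) ∧
      IsSemialgebraicMapOn ℚ {x : Fin 2 → ℝ | -1 < x 0 ∧ x 0 < 0 ∧ -1 < x 1 ∧ x 1 < 0} Φ ∧
      (∀ z, HasFDerivAt Φ (Φ' z) z) ∧
      Set.InjOn Φ {x : Fin 2 → ℝ | -1 < x 0 ∧ x 0 < 0 ∧ -1 < x 1 ∧ x 1 < 0} ∧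
      Φ '' {x : Fin 2 → ℝ | -1 < x 0 ∧ x 0 < 0 ∧ -1 < x 1 ∧ x 1 < 0} =
        {t : Fin 2 → ℝ | ∀ j, t j ∈ Set.Ioo (0:ℝ) 1} ∧
      (∀ z ∈ {x : Fin 2 → ℝ | -1 < x 0 ∧ x 0 < 0 ∧ -1 < x 1 ∧ x 1 < 0},
        |(Φ' z).det| = 4 * (z 0 * z 1)) := by
  set Φ : (Fin 2 → ℝ) → (Fin 2 → ℝ) := fun z => ![z 1 * z 1, z 0 * z 0] with hΦ
  set Φ' : (Fin 2 → ℝ) → (Fin 2 → ℝ) →L[ℝ] (Fin 2 → ℝ) :=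
    fun z => LinearMap.toContinuousLinearMap (Matrix.toLin' !![0, 2 * z 1; 2 * z 0, 0]) with hΦ'
  have hΦ0 : ∀ z, Φ z 0 = z 1 * z 1 := fun z => rfl
  have hΦ1 : ∀ z, Φ z 1 = z 0 * z 0 := fun z => rfl
  have hΦ'0 : ∀ z v : Fin 2 → ℝ, Φ' z v 0 = 0 * v 0 + 2 * z 1 * v 1 := by
    intro z v
    change Matrix.toLin' !![0, 2 * z 1; 2 * z 0, 0] v 0 = _
    rw [Matrix.toLin'_apply]
    simp [Matrix.mulVec, dotProduct, Fin.sum_univ_two]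
  have hΦ'1 : ∀ z v : Fin 2 → ℝ, Φ' z v 1 = 2 * z 0 * v 0 + 0 * v 1 := by
    intro z v
    change Matrix.toLin' !![0, 2 * z 1; 2 * z 0, 0] v 1 = _
    rw [Matrix.toLin'_apply]
    simp [Matrix.mulVec, dotProduct, Fin.sum_univ_two]
  have hdet : ∀ z, (Φ' z).det = -(4 * (z 0 * z 1)) := by
    intro z
    change LinearMap.det (Matrix.toLin' !![0, 2 * z 1; 2 * z 0, 0]) = _
    rw [LinearMap.det_toLin', Matrix.det_fin_two]
    simp
    ring
  have hderiv : ∀ z, HasFDerivAt Φ (Φ' z) z := by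
    intro z
    have h0 : HasFDerivAt (fun y : Fin 2 → ℝ => y 0)
        (ContinuousLinearMap.proj (R := ℝ) (φ := fun _ : Fin 2 => ℝ) 0) z := hasFDerivAt_apply 0 z
    have h1 : HasFDerivAt (fun y : Fin 2 → ℝ => y 1)
        (ContinuousLinearMap.proj (R := ℝ) (φ := fun _ : Fin 2 => ℝ) 1) z := hasFDerivAt_apply 1 z
    rw [hasFDerivAt_pi']
    refine Fin.forall_fin_two.mpr ⟨?_, ?_⟩
    · have hf : (fun y : Fin 2 → ℝ => Φ y 0) = fun y => y 1 * y 1 := funext fun y => rfl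
      rw [hf]
      refine (h1.mul h1).congr_fderiv (ContinuousLinearMap.ext fun v => ?_)
      simp [hΦ'0]
      ring
    · have hf : (fun y : Fin 2 → ℝ => Φ y 1) = fun y => y 0 * y 0 := funext fun y => rfl
      rw [hf]
      refine (h0.mul h0).congr_fderiv (ContinuousLinearMap.ext fun v => ?_)
      simp [hΦ'1]
      ring
  refine ⟨Φ, Φ', hΦ0, hΦ1, ?_, hderiv, ?_, ?_, fun z hz => ?_⟩
  · convert isSemialgebraicMapOn_aeval isSemialgebraic_lemniscaticSquare
      ![MvPolynomial.X 1 * MvPolynomial.X 1, MvPolynomial.X 0 * MvPolynomial.X 0] using 2 with z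
    funext i
    fin_cases i
    · simp [hΦ0]
    · simp [hΦ1]
  · rintro x ⟨-, hx0, -, hx1⟩ y ⟨-, hy0, -, hy1⟩ hxy
    have e0 := congrFun hxy 0
    have e1 := congrFun hxy 1
    simp only [hΦ0, hΦ1] at e0 e1
    have h1 : x 1 = y 1 := by
      have : (x 1 - y 1) * (x 1 + y 1) = 0 := by linear_combination e0
      rcases mul_eq_zero.1 this with h | h
      · linarith
      · linarith
    have h0 : x 0 = y 0 := by
      have : (x 0 - y 0) * (x 0 + y 0) = 0 := by linear_combination e1
      rcases mul_eq_zero.1 this with h | h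
      · linarith
      · linarith
    funext i
    fin_cases i
    · exact h0
    · exact h1
  · ext y
    constructor
    · rintro ⟨z, ⟨h0, h1, h2, h3⟩, rfl⟩
      refine Fin.forall_fin_two.mpr ⟨?_, ?_⟩
      · rw [hΦ0]
        exact ⟨mul_pos_of_neg_of_neg h3 h3, by nlinarith⟩
      · rw [hΦ1]
        exact ⟨mul_pos_of_neg_of_neg h1 h1, by nlinarith⟩
    · intro hy
      have hy0 : y 0 ∈ Set.Ioo (0:ℝ) 1 := hy 0
      have hy1 : y 1 ∈ Set.Ioo (0:ℝ) 1 := hy 1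
      have hs0 : 0 < √(y 0) := Real.sqrt_pos.2 hy0.1
      have hs1 : 0 < √(y 1) := Real.sqrt_pos.2 hy1.1
      have hs0' : √(y 0) < 1 := by
        rw [show (1:ℝ) = √1 from Real.sqrt_one.symm]
        exact Real.sqrt_lt_sqrt hy0.1.le hy0.2
      have hs1' : √(y 1) < 1 := by
        rw [show (1:ℝ) = √1 from Real.sqrt_one.symm]
        exact Real.sqrt_lt_sqrt hy1.1.le hy1.2
      refine ⟨![-√(y 1), -√(y 0)], ⟨?_, ?_, ?_, ?_⟩, ?_⟩
      · show -1 < -√(y 1); linarith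
      · show -√(y 1) < 0; linarith
      · show -1 < -√(y 0); linarith
      · show -√(y 0) < 0; linarith
      · funext i
        fin_cases i
        · show -√(y 0) * -√(y 0) = y 0
          rw [neg_mul_neg, Real.mul_self_sqrt hy0.1.le]
        · show -√(y 1) * -√(y 1) = y 1
          rw [neg_mul_neg, Real.mul_self_sqrt hy1.1.le]
  · obtain ⟨-, h1, -, h3⟩ := hz
    rw [hdet, abs_neg, abs_of_pos (by nlinarith [mul_pos_of_neg_of_neg h1 h3])]

/-! ## The pull-back identity -/

/-- `(s⁴)^{-1/4} = 1/s` for `s > 0`. [folklore] -/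
theorem rpow_four_neg_quarter {s : ℝ} (hs : 0 < s) : (s ^ 4) ^ (-(1 / 4 : ℝ)) = s⁻¹ := by
  rw [← Real.rpow_natCast s 4, ← Real.rpow_mul hs.le]
  norm_num
  exact Real.rpow_neg_one s

/-- `(s⁴)^{-3/4} = 1/s³` for `s > 0`. [folklore] -/
theorem rpow_four_neg_three_quarters {s : ℝ} (hs : 0 < s) : (s ^ 4) ^ (-(3 / 4 : ℝ)) = (s ^ 3)⁻¹ := by
  rw [← Real.rpow_natCast s 4, ← Real.rpow_mul hs.le, show ((4 : ℕ) : ℝ) * -(3 / 4 : ℝ) = -(3 : ℕ) by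
    norm_num, Real.rpow_neg hs.le, Real.rpow_natCast]

/-- `w^{-1/2} = 1/√w` for `w ≥ 0`. [folklore] -/
theorem rpow_neg_half_eq_inv_sqrt {w : ℝ} (hw : 0 ≤ w) : w ^ (-(1 / 2 : ℝ)) = (√w)⁻¹ := by
  rw [Real.rpow_neg hw, Real.sqrt_eq_rpow]

/-- `√(4x³ − 4x) = 2 s √(1 − s⁴)` at `x = −s²`, `0 < s < 1`. [folklore] -/
theorem sqrt_lemniscatic {s : ℝ} (hs : 0 < s) (hs1 : s < 1) :
    √(4 * (-(s ^ 2)) ^ 3 - 4 * (-(s ^ 2))) = 2 * s * √(1 - s ^ 4) := by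
  have h4 : 0 < 1 - s ^ 4 := by nlinarith [pow_lt_one₀ hs.le hs1 (by norm_num : (4:ℕ) ≠ 0)]
  have e : 4 * (-(s ^ 2)) ^ 3 - 4 * (-(s ^ 2)) = (2 * s * √(1 - s ^ 4)) ^ 2 := by
    rw [mul_pow, Real.sq_sqrt h4.le]
    ring
  rw [e, Real.sqrt_sq (by positivity)]

/-- **The pull-back identity** of the chart `Φ(x₀,x₁) = (x₁², x₀²)` on the lemniscatic square,
Jacobian `4x₀x₁` included: for `a, b ∈ (-1,0)`,
`−4b/(√(4a³−4a)√(4b³−4b)) = ¼ · (b²)^{-1/4}(1−b²)^{-1/2} · (a²)^{-3/4}(1−a²)^{-1/2} · 4ab`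
(both sides equal `t/(s√(1−s⁴)√(1−t⁴))` at `a = −s²`, `b = −t²`). [folklore] -/
theorem lemniscaticSquare_pullback {a b : ℝ} (ha : a ∈ Set.Ioo (-1:ℝ) 0) (hb : b ∈ Set.Ioo (-1:ℝ) 0) :
    -4 * b / (√(4 * a ^ 3 - 4 * a) * √(4 * b ^ 3 - 4 * b)) =
      (1 / 4 : ℝ) * ((b * b) ^ (-(1 / 4 : ℝ)) * (1 - b * b) ^ (-(1 / 2 : ℝ)) *
        ((a * a) ^ (-(3 / 4 : ℝ)) * (1 - a * a) ^ (-(1 / 2 : ℝ)))) * (4 * (a * b)) := by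
  obtain ⟨s, hs, hs1, rfl⟩ : ∃ s, 0 < s ∧ s < 1 ∧ a = -(s ^ 2) := by
    refine ⟨√(-a), Real.sqrt_pos.2 (by linarith [ha.2]), ?_, ?_⟩
    · rw [show (1:ℝ) = √1 from Real.sqrt_one.symm]
      exact Real.sqrt_lt_sqrt (by linarith [ha.2]) (by linarith [ha.1])
    · rw [Real.sq_sqrt (by linarith [ha.2])]; ring
  obtain ⟨t, ht, ht1, rfl⟩ : ∃ t, 0 < t ∧ t < 1 ∧ b = -(t ^ 2) := by
    refine ⟨√(-b), Real.sqrt_pos.2 (by linarith [hb.2]), ?_, ?_⟩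
    · rw [show (1:ℝ) = √1 from Real.sqrt_one.symm]
      exact Real.sqrt_lt_sqrt (by linarith [hb.2]) (by linarith [hb.1])
    · rw [Real.sq_sqrt (by linarith [hb.2])]; ring
  have hs4 : 0 < 1 - s ^ 4 := by nlinarith [pow_lt_one₀ hs.le hs1 (by norm_num : (4:ℕ) ≠ 0)]
  have ht4 : 0 < 1 - t ^ 4 := by nlinarith [pow_lt_one₀ ht.le ht1 (by norm_num : (4:ℕ) ≠ 0)]
  have e1 : -(t ^ 2) * -(t ^ 2) = t ^ 4 := by ring
  have e2 : -(s ^ 2) * -(s ^ 2) = s ^ 4 := by ring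
  rw [sqrt_lemniscatic hs hs1, sqrt_lemniscatic ht ht1, e1, e2, rpow_four_neg_quarter ht,
    rpow_four_neg_three_quarters hs, rpow_neg_half_eq_inv_sqrt hs4.le,
    rpow_neg_half_eq_inv_sqrt ht4.le]
  have hA : 0 < √(1 - s ^ 4) := Real.sqrt_pos.2 hs4
  have hB : 0 < √(1 - t ^ 4) := Real.sqrt_pos.2 ht4
  field_simp
  ring

/-! ## The move -/

/-- **`[(-1,0)², −4x₁/(y₀y₁)] ∼ ¼ · [(0,1)², u^{-1/4}(1−u)^{-1/2} v^{-3/4}(1−v)^{-1/2}]`** for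
representations PINNED by domain and integrand (`B` pinned as the cube Beta representation of the
data `x = (¾, ¼)`, `y = (½, ½)`): ONE change of variables along `Φ(x₀,x₁) = (x₁², x₀²)` (rule (2)).
Value identity `ω₁η₁ = ¼·B(¾,½)·B(¼,½)` for `y² = 4x³ − 4x`.
[cite: KontsevichZagier2001, §1.2 rule (2)] -/
theorem lemniscaticSquare_equivalent_constMul (r B : IntegralRep 2)
    (hq : IsAlgebraic ℚ (((1 / 4 : ℚ) : ℚ) : ℝ))
    (hrd : r.domain = {x | -1 < x 0 ∧ x 0 < 0 ∧ -1 < x 1 ∧ x 1 < 0})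
    (hri : Set.EqOn r.integrand (fun x => -4 * x 1 /
      (Real.sqrt (4 * x 0 ^ 3 - 4 * x 0) * Real.sqrt (4 * x 1 ^ 3 - 4 * x 1))) r.domain)
    (hBd : B.domain = {t | ∀ j, t j ∈ Set.Ioo (0:ℝ) 1})
    (hBi : Set.EqOn B.integrand (fun t => ∏ j, (t j) ^ (((![3 / 4, 1 / 4] : Fin 2 → ℚ) j : ℝ) - 1) *
      (1 - t j) ^ (((![1 / 2, 1 / 2] : Fin 2 → ℚ) j : ℝ) - 1)) B.domain) :
    Equivalent r (B.constMul (((1 / 4 : ℚ) : ℚ) : ℝ) hq) := by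
  obtain ⟨Φ, Φ', hΦ0, hΦ1, hsa, hderiv, hinj, himage, hdet⟩ := exists_lemniscaticSquareChart
  refine changeOfVariablesRel_subset_relations
    ⟨2, r, B.constMul _ hq, Φ, Φ', by rw [hrd]; exact hsa, fun x _ => (hderiv x).hasFDerivWithinAt,
      by rw [hrd]; exact hinj, by rw [hrd, IntegralRep.domain_constMul, hBd, himage], fun z hz => ?_,
      rfl⟩
  have hz' : -1 < z 0 ∧ z 0 < 0 ∧ -1 < z 1 ∧ z 1 < 0 := by rw [hrd] at hz; exact hz
  have hΦz : Φ z ∈ B.domain := by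
    rw [hBd, ← himage]
    exact mem_image_of_mem Φ hz'
  rw [hri hz, IntegralRep.integrand_constMul]
  dsimp only
  rw [hBi hΦz, hdet z hz']
  simp only [Fin.prod_univ_two, Matrix.cons_val_zero, Matrix.cons_val_one, hΦ0, hΦ1]
  have e1 : (((3 / 4 : ℚ)) : ℝ) - 1 = -(1 / 4 : ℝ) := by norm_num
  have e2 : (((1 / 2 : ℚ)) : ℝ) - 1 = -(1 / 2 : ℝ) := by norm_num
  have e3 : (((1 / 4 : ℚ)) : ℝ) - 1 = -(3 / 4 : ℝ) := by norm_num
  have e4 : (((1 / 4 : ℚ)) : ℝ) = (1 / 4 : ℝ) := by norm_num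
  rw [e1, e2, e3, e4]
  exact lemniscaticSquare_pullback ⟨hz'.1, hz'.2.1⟩ ⟨hz'.2.2.1, hz'.2.2.2⟩

/-- The Beta box `[(0,1)², u^{3/4-1}(1−u)^{1/2-1} · v^{1/4-1}(1−v)^{1/2-1}]` exists (cube Beta
representation of the data `x = (¾, ¼)`, `y = (½, ½)`, `KZ.exists_cubeBetaRep`). [folklore] -/
theorem exists_lemniscaticBetaBox :
    ∃ B : IntegralRep 2, B.domain = {t | ∀ j, t j ∈ Set.Ioo (0:ℝ) 1} ∧
      Set.EqOn B.integrand (fun t => ∏ j, (t j) ^ (((![3 / 4, 1 / 4] : Fin 2 → ℚ) j : ℝ) - 1) *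
        (1 - t j) ^ (((![1 / 2, 1 / 2] : Fin 2 → ℚ) j : ℝ) - 1)) B.domain :=
  exists_cubeBetaRep ![3 / 4, 1 / 4] ![1 / 2, 1 / 2] fun j => by fin_cases j <;> norm_num

end Summit.KontsevichZagierPeriods.KontsevichZagierPeriods.Theorems
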